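import Mathlib
import Summits.ValiantsHypothesis.ValiantsHypothesis.Theorems.LacunarySymmetroidMatrixDescartesDefiniteMomentsDirectedWindows
import Summits.ValiantsHypothesis.ValiantsHypothesis.Theorems.LacunarySymmetroidMatrixDescartesInertiaParity
import Summits.ValiantsHypothesis.ValiantsHypothesis.Theorems.LacunarySymmetroidMatrixDescartesDefiniteMomentsZonesRayleigh

/-!
# `MatrixDescartes` (stmt-ValiantsHypothesis-18050) — the DEFINITE-MOMENTS LAW, zones EXACT VI: THE INTRINSIC ONE-CROSSING LAW —
# lowest letter positive definite and every Rayleigh `K`-nomial with at most ONE positive root (counted with multiplicity)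
# ⇒ `Z₊ ≤ m`, indeed the kernels at the positive roots have total dimension at most `m`

HONEST FRAMING.  Cell `pub-symmetroid`, seat `val-sym-mdr-p2` (gen 16); helper file `--supports` the crux
`Theses.LacunarySymmetroid.MatrixDescartes`, NO closure claim.  An INTRINSIC sector law beside the crux (the `R = 1` companion
of the Rayleigh-sharp sector `R = K − 1`): the hypothesis is a property of the pencil's Rayleigh `K`-nomials — no sign pattern
of the letters `S₁, …, S_{K−1}` is assumed (gen 4's `LoewnerSector` / `oneAlternation` and gen 15's word laws need a
semidefinite sign word).  Nothing here bears on the crux in its window, on `stub_twoSided`, on `DoorA26`/`DoorA34`, registers,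
or `VP ≠ VNP`.

THEOREM (`card_posRoots_le_of_oneCrossing`).  `F(x) = ∑ₗ x^{dₗ} Sₗ`, `K ≥ 2` real symmetric `ι × ι` letters at strictly
increasing exponents, lowest letter `S₀ ≻ 0`.  If every Rayleigh `K`-nomial `P_v = ∑ₗ (vᵀSₗv)X^{dₗ}` (`v ≠ 0`) has AT MOST ONE
positive root counted with multiplicity, then `det F` has at most `card ι` distinct positive roots; indeed
`∑_{t > 0, det F(t) = 0} dim ker F(t) ≤ card ι` (`sum_corank_posRoots_le_of_oneCrossing`).  PROOF: `P_v > 0` near `0⁺`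
(`S₀ ≻ 0`), so a non-positive value at `s` puts the unique positive root in `(0, s]`, after which `P_v < 0` (parity of a
single simple crossing, `Inertia.neg_one_pow_card_roots_mul_eval_mul_eval_pos`): the whole half-line is ONE negatively
directed window, and the directed Sylvester climb (`DefiniteMoments.negIndex_add_sum_corank_le_of_directed`) bounds the total
kernel dimension by the index jump `≤ card ι`. [folklore]; axioms standard; no definitions.
-/

-- layout Summits/ValiantsHypothesis/ValiantsHypothesis forces the duplicated namespace component
set_option linter.dupNamespace false

namespace Summit.ValiantsHypothesis.ValiantsHypothesis.Theorems.LacunarySymmetroidMatrixDescartes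

open Polynomial Matrix Finset
open scoped BigOperators Topology

namespace DefiniteMoments

variable {ι : Type} [Fintype ι] [DecidableEq ι]

/-! ## §1 One crossing makes the half-line a directed window -/

omit [DecidableEq ι] in
/-- **One-crossing propagation.**  `S₀ ≻ 0` at the lowest exponent and `P_v` with at most one positive root counted with
multiplicity: then `P_v(s) ≤ 0` at a positive scale forces `P_v(t) < 0` at every later scale. [folklore] -/
theorem propagate_of_oneCrossing {K : ℕ} (hK : 2 ≤ K) (d : Fin K → ℕ) (hd : StrictMono d) (S : Fin K → Matrix ι ι ℝ)
    (h0 : ∀ v : ι → ℝ, v ≠ 0 → 0 < v ⬝ᵥ (S ⟨0, by omega⟩ *ᵥ v))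
    (hone : ∀ v : ι → ℝ, v ≠ 0 →
      Multiset.card ((∑ l, C (v ⬝ᵥ (S l *ᵥ v)) * (X : ℝ[X]) ^ d l).roots.filter (fun t => 0 < t)) ≤ 1)
    (v : ι → ℝ) (hv : v ≠ 0) {s t : ℝ} (hs : 0 < s) (hst : s < t)
    (hfs : v ⬝ᵥ ((∑ k, s ^ d k • S k) *ᵥ v) ≤ 0) : v ⬝ᵥ ((∑ k, t ^ d k • S k) *ᵥ v) < 0 := by
  classical
  set P := ∑ l, C (v ⬝ᵥ (S l *ᵥ v)) * (X : ℝ[X]) ^ d l with hP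
  have hv0 : v ⬝ᵥ (S ⟨0, by omega⟩ *ᵥ v) ≠ 0 := (h0 v hv).ne'
  have htc : 0 < (1 : ℝ) * P.trailingCoeff := by
    rw [one_mul, hP, trailingCoeff_rayleighPoly hK d hd S v hv0]; exact h0 v hv
  have hP0 : P ≠ 0 := fun h => by rw [h, trailingCoeff_zero, mul_zero] at htc; exact lt_irrefl 0 htc
  have honeP : Multiset.card (P.roots.filter (fun x => 0 < x)) ≤ 1 := hone v hv
  obtain ⟨δ, hδ, hnear⟩ := eventually_pos_near_zero P 1 htc
  -- a small positive scale `ε < s` with `P(ε) > 0`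
  set ε := min (δ / 2) (s / 2) with hε
  have hε0 : 0 < ε := lt_min (by linarith) (by linarith)
  have hεδ : ε < δ := lt_of_le_of_lt (min_le_left _ _) (by linarith)
  have hεs : ε < s := lt_of_le_of_lt (min_le_right _ _) (by linarith)
  have hPε : 0 < P.eval ε := by have := hnear ε hε0 hεδ; rwa [one_mul] at this
  have hPs : P.eval s ≤ 0 := by rw [hP, eval_rayleighPoly]; exact hfs
  -- the unique positive root `ρ ∈ (ε, s]`
  obtain ⟨ρ, hρ, hPρ⟩ : ∃ ρ ∈ Set.Icc ε s, P.eval ρ = 0 :=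
    intermediate_value_Icc' hεs.le P.continuous.continuousOn ⟨hPs, hPε.le⟩
  have hρε : ε < ρ := lt_of_le_of_ne hρ.1 fun h => by rw [← h] at hPρ; exact hPε.ne' hPρ
  have hρroot : ρ ∈ P.roots := (mem_roots hP0).2 hPρ
  -- no second positive root: `P(t) ≠ 0`
  have hsub : ∀ u : ℝ, ε < u → P.roots.filter (fun x => ε < x ∧ x < u) ≤ P.roots.filter (fun x => 0 < x) :=
    fun u _ => Multiset.monotone_filter_right _ fun x hx => lt_trans hε0 hx.1
  have hPt : P.eval t ≠ 0 := by
    intro ht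
    have htroot : t ∈ P.roots := (mem_roots hP0).2 ht
    have hρt : ρ ≠ t := ne_of_lt (lt_of_le_of_lt hρ.2 hst)
    have h2 : 2 ≤ Multiset.card (P.roots.filter (fun x => 0 < x)) := by
      have hpair : ({ρ, t} : Finset ℝ) ⊆ (P.roots.filter (fun x => 0 < x)).toFinset := by
        intro x hx
        rw [Finset.mem_insert, Finset.mem_singleton] at hx
        rw [Multiset.mem_toFinset, Multiset.mem_filter]
        rcases hx with rfl | rfl
        · exact ⟨hρroot, lt_trans hε0 hρε⟩
        · exact ⟨htroot, lt_trans hs hst⟩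
      calc 2 = ({ρ, t} : Finset ℝ).card := (Finset.card_pair hρt).symm
        _ ≤ (P.roots.filter (fun x => 0 < x)).toFinset.card := Finset.card_le_card hpair
        _ ≤ _ := Multiset.toFinset_card_le _
    omega
  -- exactly one root in `(ε, t)`, counted with multiplicity
  have hcount : Multiset.card (P.roots.filter (fun x => ε < x ∧ x < t)) = 1 := by
    apply le_antisymm
    · exact le_trans (Multiset.card_le_card (hsub t (lt_trans hεs hst))) honeP
    · have hmem : ρ ∈ P.roots.filter (fun x => ε < x ∧ x < t) :=
        Multiset.mem_filter.2 ⟨hρroot, hρε, lt_of_le_of_lt hρ.2 hst⟩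
      exact Multiset.card_pos_iff_exists_mem.2 ⟨ρ, hmem⟩
  have hsign := Inertia.neg_one_pow_card_roots_mul_eval_mul_eval_pos 1 P (lt_trans hεs hst).le hPε.ne' hPt hcount
  rw [pow_one, neg_one_mul, neg_pos] at hsign
  have hPt' : P.eval t < 0 := by
    by_contra h
    push Not at h
    exact absurd hsign (not_lt.2 (mul_nonneg hPε.le h))
  rw [hP, eval_rayleighPoly] at hPt'
  exact hPt'

/-! ## §2 The intrinsic one-crossing law -/

/-- **THE INTRINSIC ONE-CROSSING LAW (kernel-dimension form).**  `K ≥ 2` real symmetric letters at strictly increasing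
exponents, `S₀ ≻ 0`, every Rayleigh `K`-nomial with at most one positive root counted with multiplicity.  Then the kernels of
`F` at the positive roots of `det F` have total dimension at most `card ι`. [folklore] -/
theorem sum_corank_posRoots_le_of_oneCrossing {K : ℕ} (hK : 2 ≤ K) (d : Fin K → ℕ) (hd : StrictMono d)
    (S : Fin K → Matrix ι ι ℝ) (hS : ∀ l, (S l).IsSymm)
    (h0 : ∀ v : ι → ℝ, v ≠ 0 → 0 < v ⬝ᵥ (S ⟨0, by omega⟩ *ᵥ v))
    (hone : ∀ v : ι → ℝ, v ≠ 0 →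
      Multiset.card ((∑ l, C (v ⬝ᵥ (S l *ᵥ v)) * (X : ℝ[X]) ^ d l).roots.filter (fun t => 0 < t)) ≤ 1) :
    ∑ t ∈ (Matrix.det (∑ k, ((X : ℝ[X]) ^ d k) • (S k).map C)).roots.toFinset.filter (fun t => 0 < t),
        (Fintype.card ι - (∑ k, t ^ d k • S k).rank) ≤ Fintype.card ι := by
  classical
  set P := Matrix.det (∑ k, ((X : ℝ[X]) ^ d k) • (S k).map C) with hP
  set R := P.roots.toFinset.filter (fun t => 0 < t) with hR
  rcases R.eq_empty_or_nonempty with hRe | hRne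
  · rw [hRe, Finset.sum_empty]; exact Nat.zero_le _
  -- a window `(a, b)` containing every positive root
  set a := R.min' hRne / 2 with ha
  set b := R.max' hRne + 1 with hb
  have hmin0 : 0 < R.min' hRne := (Finset.mem_filter.1 (Finset.min'_mem R hRne)).2
  have ha0 : 0 < a := by rw [ha]; linarith
  have hab : a < b := by
    have h1 : R.min' hRne ≤ R.max' hRne := Finset.min'_le R _ (Finset.max'_mem R hRne)
    rw [ha, hb]; linarith
  have hRsub : R ⊆ P.roots.toFinset.filter (fun t => a < t ∧ t < b) := by
    intro t ht
    have htR := ht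
    obtain ⟨htr, ht0⟩ := Finset.mem_filter.1 ht
    refine Finset.mem_filter.2 ⟨htr, ?_, ?_⟩
    · have := Finset.min'_le R t htR; rw [ha]; linarith
    · have := Finset.le_max' R t htR; rw [hb]; linarith
  have hH := Inertia.isHermitian_pencil d S hS
  have hdir := negIndex_add_sum_corank_le_of_directed (fun x : ℝ => ∑ k, x ^ d k • S k) hH P.roots.toFinset _ a b hab
    le_rfl (fun v hv s t has hst _ hfs =>
      propagate_of_oneCrossing hK d hd S h0 hone v hv (lt_of_lt_of_le ha0 has) hst hfs)
  beta_reduce at hdir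
  have hνb := Fintype.card_subtype_le fun j => (hH b).eigenvalues j < 0
  calc ∑ t ∈ R, (Fintype.card ι - (∑ k, t ^ d k • S k).rank)
      ≤ ∑ t ∈ P.roots.toFinset.filter (fun t => a < t ∧ t < b), (Fintype.card ι - (∑ k, t ^ d k • S k).rank) :=
        Finset.sum_le_sum_of_subset_of_nonneg hRsub fun _ _ _ => Nat.zero_le _
    _ ≤ Fintype.card ι := by omega

/-- **THE INTRINSIC ONE-CROSSING LAW.**  `K ≥ 2` real symmetric `ι × ι` letters at strictly increasing exponents with `S₀ ≻ 0`;
if every Rayleigh `K`-nomial `∑ₗ (vᵀSₗv) X^{dₗ}` (`v ≠ 0`) has at most ONE positive root counted with multiplicity, then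
`det (∑ₗ X^{dₗ} Sₗ)` has at most `card ι` distinct positive roots. [folklore] -/
theorem card_posRoots_le_of_oneCrossing {K : ℕ} (hK : 2 ≤ K) (d : Fin K → ℕ) (hd : StrictMono d)
    (S : Fin K → Matrix ι ι ℝ) (hS : ∀ l, (S l).IsSymm)
    (h0 : ∀ v : ι → ℝ, v ≠ 0 → 0 < v ⬝ᵥ (S ⟨0, by omega⟩ *ᵥ v))
    (hone : ∀ v : ι → ℝ, v ≠ 0 →
      Multiset.card ((∑ l, C (v ⬝ᵥ (S l *ᵥ v)) * (X : ℝ[X]) ^ d l).roots.filter (fun t => 0 < t)) ≤ 1) :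
    ((Matrix.det (∑ k, ((X : ℝ[X]) ^ d k) • (S k).map C)).roots.toFinset.filter (fun t => 0 < t)).card
      ≤ Fintype.card ι := by
  classical
  refine le_trans ?_ (sum_corank_posRoots_le_of_oneCrossing hK d hd S hS h0 hone)
  rw [Finset.card_eq_sum_ones]
  refine Finset.sum_le_sum fun t ht => one_le_corank_of_det_eq_zero ?_
  exact det_eval_eq_zero_of_mem d S (Finset.mem_filter.1 ht).1

end DefiniteMoments

end Summit.ValiantsHypothesis.ValiantsHypothesis.Theorems.LacunarySymmetroidMatrixDescartes
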